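import Mathlib.Analysis.Distribution.SchwartzSpace.Fourier
import Mathlib.Analysis.Calculus.BumpFunction.FiniteDimension
import Mathlib.Analysis.InnerProductSpace.EuclideanDist
import Literature.Analysis.FunctionSpaces.NuclearSpace
import Literature.MathematicalPhysics.QuantumLattice.SchwartzFourierDensity
import HarnessLib

/-!
# Nuclearity of the Schwartz space: the seminorm estimates

Support file for the discharge of the named facts `Literature.Analysis.FunctionSpaces.nuclearSpace_schwartzMap` and
`Literature.Analysis.FunctionSpaces.separableSpace_schwartzMap` of `Literature/Analysis/FunctionSpaces/NuclearSpace.lean`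
(nuclearity and separability of `𝓢(E, F)`, consumed by Minlos' theorem for `𝒮'`,
`Literature/Analysis/FunctionSpaces/Minlos.lean`, and by `Literature.MathematicalPhysics.QuantumFieldTheory.bochner_minlos`).

`Literature.NuclearSpace ℝ V` is Pietsch's intrinsic (seminorm) form of nuclearity (Pietsch 1972,
Prop. 4.1.4): every continuous seminorm `p` is dominated by a *nuclear* seminorm,
`p ≤ ∑ₐ |φₐ|` with continuous linear functionals `φₐ`, `|φₐ| ≤ cₐ q`, `∑ cₐ < ∞`, `q` continuous.
This file proves the analytic estimates giving this for the Schwartz space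
`𝓢(ℝ^ι, ℂ)` (`ℝ^ι = EuclideanSpace ℝ ι`), regarded as a *real* locally convex space with Mathlib's
seminorms `p_{k,n}(f) = sup_x ‖x‖^k ‖Dⁿf(x)‖` (`SchwartzMap.seminorm ℝ k n`):

* `Literature.Analysis.FunctionSpaces.SchwartzNuclear.exists_nuclear_dominating_seminorm_zero`: for every `k` there are
  countably many continuous real-linear functionals `φₐ` on `𝓢(ℝ^ι, ℂ)`, a continuous seminorm
  `q` and a summable family `cₐ ≥ 0` with `|φₐ(f)| ≤ cₐ q(f)` and `p_{k,0}(f) ≤ ∑ₐ |φₐ(f)|`;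
* `Literature.Analysis.FunctionSpaces.SchwartzNuclear.seminorm_le_sum_seminorm_iteratedLineDeriv`:
  `p_{k,n}(f) ≤ ∑_{J : Fin n → ι} p_{k,0}(∂^{e_J} f)` (expand the `n`-linear map `Dⁿf(x)` in the
  standard basis), which reduces the seminorms `p_{k,n}` to the order-zero ones along the
  continuous linear maps `f ↦ ∂^{e_J} f`.

The passage from these estimates to `NuclearSpace ℝ 𝓢(E, F)` (reindexing by `ℕ`, finite sums
of nuclearly dominated seminorms, transport along `E ≃L ℝ^ι` and a basis of `F`) is in
`Literature/Analysis/FunctionSpaces/NuclearSpaceSchwartzProofs.lean`. All the auxiliary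
constructions of this file (the cube lattice `side`, `center`, `cubeIndex`, the bump `cutoff`, the
localisation maps `cut`, the functionals `phiRe`, `phiIm`, `phi`, …) are `private`: only the
definition-free theorems listed above (and `exists_fourier_decay`, `norm_boxCoeff_refl`,
`norm_le_tsum_norm_fourier`) are exported.

## The functionals and the proof

Cover `ℝ^ι` by the lattice of cubes `Q_m`, `m ∈ ℤ^ι`, of side `s = 1/(4(d+1))`, `d = |ι|`, with
centres `z_m = s(m + ½𝟙)`; every point of `Q_m` is within `1/8` of `z_m`
(`norm_sub_center_cubeIndex_le`). Let `χ` be a smooth bump equal to `1` on `B(0, 1/8)` and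
supported in `B(0, 1/4)` (Mathlib's `ContDiffBump`) and `χ_m = χ(· - z_m)`. For `f ∈ 𝓢(ℝ^ι, ℂ)` and
`x ∈ Q_m` we have `f(x) = (χ_m f)(x)`, and `χ_m f` is supported in `B(z_m, 1/4)`, well inside the
unit period box centred at `z_m`; so `(χ_m f)(x)` is the sum of its Fourier series in that box,
whose coefficients have moduli `|𝓕(χ_m f)(n)|`, `n ∈ ℤ^ι` (the tree's
`Literature.MathematicalPhysics.QuantumLattice.hasSum_boxCoeff_mul_eChar`, `SchwartzFourierDensity`; a translation changes `𝓕` only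
by a phase, `norm_boxCoeff_refl`). Hence (`pow_mul_norm_le_tsum`)

  `‖x‖^k |f(x)| ≤ (1 + ‖z_m‖)^k ∑ₙ |𝓕(χ_m f)(n)| ≤ ∑_{m,n} |φ_{m,n}(f)|`,
  `φ_{m,n}(f) = (1 + ‖z_m‖)^k 𝓕(χ_m f)(n)`

(split into real and imaginary parts, `phiRe`, `phiIm`, to get real-valued functionals).
Domination (`exists_dominating`): the Schwartz decay of the Fourier transform,
`(1 + ‖ξ‖)^N |𝓕G(ξ)| ≤ C · (finite sup of p_{a,b}(G))` (continuity of `𝓕` on `𝓢`,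
`exists_fourier_decay`), and the Leibniz/support estimate
`p_{a,b}(χ_m f) ≤ K (1 + ‖z_m‖)^{-M} · (finite sup of p_{a',b'}(f))` (`exists_seminorm_cut_le`:
the derivatives of `χ_m` are bounded uniformly in `m` and `χ_m f` lives where
`1 + ‖x‖ ≥ (4/5)(1 + ‖z_m‖)`) give `|φ_{m,n}(f)| ≤ C K (1 + ‖z_m‖)^{-N} (1 + ‖n‖)^{-N} q(f)` with
`N = 2d`, a summable family (`Literature.MathematicalPhysics.QuantumLattice.summable_pi_inv_one_add_abs_sq`).

This localisation-plus-Fourier-series argument is an elementary variant of the classical proofs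
of the nuclearity of `𝒮` (Grothendieck 1955, Ch. II §2 no. 3; Pietsch 1972, 6.2.5, who dominates
the sup-seminorms of `𝒮(ℝ)` by an *integral* of point evaluations of derivatives,
`s_r(f) ≤ ∫ |⟨f, a⟩| dμ(a)`, and concludes by the Radon-measure form Prop. 4.1.5 of nuclearity —
here the integral is replaced by a sum over lattice Fourier coefficients, matching the series
form Prop. 4.1.4; Trèves 1967, Thm 51.5, via `𝒮 ≅ s`; Gel'fand–Vilenkin IV, Ch. I §3.6, via the
Hermite expansion). Only the *statements* discharged in `NuclearSpaceSchwartzProofs` are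
attributed to these sources; the lemmas of this file are folklore estimates.

## References

* A. Grothendieck, *Produits tensoriels topologiques et espaces nucléaires*, Mem. AMS 16 (1955),
  Ch. II §2 no. 3.
* A. Pietsch, *Nuclear locally convex spaces*, Ergebnisse 66, Springer (1972), Prop. 4.1.4
  (series form of nuclearity), Prop. 4.1.5 (Radon-measure form), 6.2.5 (`𝒮` is nuclear).
* F. Trèves, *Topological vector spaces, distributions and kernels* (1967), Thm 51.5.
* I. M. Gel'fand, N. Ya. Vilenkin, *Generalized Functions IV* (1964), Ch. I §3.6.

## Mathlib

Used: `SchwartzMap.seminorm`, `schwartz_withSeminorms`, `SchwartzMap.fourierTransformCLM`,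
`Seminorm.bound_of_continuous`, `SchwartzMap.one_add_le_sup_seminorm_apply`, `ContDiffBump`,
`HasCompactSupport.toSchwartzMap`, `SchwartzMap.smulLeftCLM`, `SchwartzMap.compSubConstCLM`,
`norm_iteratedFDeriv_smul_le` (Leibniz), `VectorFourier.fourierIntegral_comp_add_right`,
`EuclideanSpace.basisFun`, `ContinuousMultilinearMap.map_sum`/`map_smul_univ`,
`SchwartzMap.iteratedLineDerivOp_eq_iteratedFDeriv`. Nuclear spaces are absent from Mathlib at
the pin.
-/

open scoped SchwartzMap NNReal Topology LineDeriv FourierTransform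
open MeasureTheory Filter Set Function Metric

noncomputable section

namespace Literature.Analysis.FunctionSpaces

namespace SchwartzNuclear

open Literature.MathematicalPhysics.QuantumLattice

section Multilinear

variable {ι : Type*} [Fintype ι] [DecidableEq ι]
variable {F : Type*} [NormedAddCommGroup F] [NormedSpace ℝ F]

/-! ### Multilinear maps on `ℝ^ι`: the norm is controlled by the values on basis tuples -/

/-- For a continuous multilinear map `A` on `(ℝ^ι)^n`, `‖A‖ ≤ ∑_{J : Fin n → ι} ‖A (e_{J 0}, …)‖`
where `e_c` is the standard basis (expand each argument in the basis). [folklore] -/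
theorem norm_le_sum_apply_single {n : ℕ}
    (A : ContinuousMultilinearMap ℝ (fun _ : Fin n => EuclideanSpace ℝ ι) F) :
    ‖A‖ ≤ ∑ J : Fin n → ι, ‖A fun j => EuclideanSpace.single (J j) (1 : ℝ)‖ := by
  refine ContinuousMultilinearMap.opNorm_le_bound (Finset.sum_nonneg fun _ _ => norm_nonneg _)
    fun m => ?_
  have hm : m = fun j => ∑ c, (m j c) • EuclideanSpace.single c (1 : ℝ) := by
    funext j
    conv_lhs => rw [← (EuclideanSpace.basisFun ι ℝ).sum_repr (m j)]
    simp [EuclideanSpace.basisFun_apply]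
  have hexp : A m = ∑ J : Fin n → ι, (∏ j, m j (J j)) • A fun j => EuclideanSpace.single (J j) 1 := by
    conv_lhs => rw [hm]
    rw [ContinuousMultilinearMap.map_sum]
    refine Finset.sum_congr rfl fun J _ => ?_
    exact A.map_smul_univ (fun j => m j (J j)) fun j => EuclideanSpace.single (J j) 1
  rw [hexp, Finset.sum_mul]
  refine (norm_sum_le _ _).trans (Finset.sum_le_sum fun J _ => ?_)
  rw [norm_smul, mul_comm]
  refine mul_le_mul_of_nonneg_left ?_ (norm_nonneg _)
  rw [norm_prod]
  exact Finset.prod_le_prod (fun j _ => norm_nonneg _) fun j _ => by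
    simpa using PiLp.norm_apply_le (m j) (J j)

/-- The Schwartz seminorm `p_{k,n}` on `𝓢(ℝ^ι, F)` is controlled by the order-zero seminorms of
the `n`-fold directional derivatives along basis vectors:
`p_{k,n}(f) ≤ ∑_{J : Fin n → ι} p_{k,0}(∂_{e_J} f)`. [folklore] -/
theorem seminorm_le_sum_seminorm_iteratedLineDeriv (k n : ℕ) (f : 𝓢(EuclideanSpace ℝ ι, F)) :
    SchwartzMap.seminorm ℝ k n f ≤
      ∑ J : Fin n → ι, SchwartzMap.seminorm ℝ k 0
        (∂^{fun j => EuclideanSpace.single (J j) (1 : ℝ)} f) := by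
  refine SchwartzMap.seminorm_le_bound ℝ k n f (Finset.sum_nonneg fun _ _ => apply_nonneg _ _)
    fun x => ?_
  calc ‖x‖ ^ k * ‖iteratedFDeriv ℝ n f x‖
      ≤ ‖x‖ ^ k * ∑ J : Fin n → ι,
          ‖iteratedFDeriv ℝ n f x fun j => EuclideanSpace.single (J j) (1 : ℝ)‖ := by
        gcongr
        exact norm_le_sum_apply_single _
    _ = ∑ J : Fin n → ι, ‖x‖ ^ k *
          ‖iteratedFDeriv ℝ 0 (⇑(∂^{fun j => EuclideanSpace.single (J j) (1 : ℝ)} f)) x‖ := by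
        rw [Finset.mul_sum]
        refine Finset.sum_congr rfl fun J _ => ?_
        rw [norm_iteratedFDeriv_zero, SchwartzMap.iteratedLineDerivOp_eq_iteratedFDeriv]
    _ ≤ _ := Finset.sum_le_sum fun J _ => SchwartzMap.le_seminorm ℝ k 0 _ x


end Multilinear


variable {ι : Type*} [Fintype ι]

/-! ### Geometry of the cube lattice -/

variable (ι) in
/-- Side length `s = 1 / (4 (d + 1))`, `d = |ι|`, of the lattice of cubes used to localise. [folklore] -/
private def side : ℝ := 1 / (4 * ((Fintype.card ι : ℝ) + 1))

/-- `0 < s`. [folklore] -/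
private theorem side_pos : 0 < side ι := by
  unfold side; positivity

/-- `s ≤ 1`. [folklore] -/
private theorem side_le_one : side ι ≤ 1 := by
  unfold side
  rw [div_le_one (by positivity)]
  nlinarith [(Nat.cast_nonneg (Fintype.card ι) : (0 : ℝ) ≤ Fintype.card ι)]

/-- `d (s/2)² ≤ (1/8)²`: a cube of side `s` has circumradius at most `1/8`. [folklore] -/
private theorem card_mul_side_sq_le : (Fintype.card ι : ℝ) * (side ι / 2) ^ 2 ≤ (1 / 8) ^ 2 := by
  unfold side
  have hd : (0 : ℝ) ≤ Fintype.card ι := Nat.cast_nonneg _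
  rw [show (Fintype.card ι : ℝ) * (1 / (4 * ((Fintype.card ι : ℝ) + 1)) / 2) ^ 2 =
    (Fintype.card ι : ℝ) / (64 * ((Fintype.card ι : ℝ) + 1) ^ 2) by field_simp; ring]
  rw [div_le_iff₀ (by positivity)]
  nlinarith

/-- Centre `z_m = s (m + ½·𝟙)` of the lattice cube with index `m ∈ ℤ^ι`. [folklore] -/
private def center (m : ι → ℤ) : EuclideanSpace ℝ ι :=
  WithLp.toLp 2 fun c => side ι * ((m c : ℝ) + 1 / 2)

/-- Coordinates of the centre `z_m`. [folklore] -/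
@[simp]
private theorem center_apply (m : ι → ℤ) (c : ι) : center m c = side ι * ((m c : ℝ) + 1 / 2) := rfl

/-- The index of the lattice cube containing `x`: `m_c = ⌊x_c / s⌋`. [folklore] -/
private def cubeIndex (x : EuclideanSpace ℝ ι) : ι → ℤ := fun c => ⌊x c / side ι⌋

/-- Every point is within `1/8` of the centre of its lattice cube. [folklore] -/
private theorem norm_sub_center_cubeIndex_le (x : EuclideanSpace ℝ ι) :
    ‖x - center (cubeIndex x)‖ ≤ 1 / 8 := by
  have hs := side_pos (ι := ι)
  have hc : ∀ c, ‖(x - center (cubeIndex x)) c‖ ^ 2 ≤ (side ι / 2) ^ 2 := by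
    intro c
    rw [Real.norm_eq_abs, sq_abs]
    have h1 : ((⌊x c / side ι⌋ : ℤ) : ℝ) ≤ x c / side ι := Int.floor_le _
    have h2 : x c / side ι < (⌊x c / side ι⌋ : ℤ) + 1 := Int.lt_floor_add_one _
    have h3 : side ι * ((⌊x c / side ι⌋ : ℤ) : ℝ) ≤ x c := by
      rwa [← le_div_iff₀' hs]
    have h4 : x c < side ι * (((⌊x c / side ι⌋ : ℤ) : ℝ) + 1) := by
      rwa [← div_lt_iff₀' hs]
    have h5 : (x - center (cubeIndex x)) c = x c - side ι * (((⌊x c / side ι⌋ : ℤ) : ℝ) + 1 / 2) :=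
      rfl
    rw [h5]
    apply sq_le_sq'
    · linarith
    · linarith
  rw [EuclideanSpace.norm_eq]
  calc √(∑ c, ‖(x - center (cubeIndex x)) c‖ ^ 2)
      ≤ √(∑ _c : ι, (side ι / 2) ^ 2) := Real.sqrt_le_sqrt (Finset.sum_le_sum fun c _ => hc c)
    _ = √((Fintype.card ι : ℝ) * (side ι / 2) ^ 2) := by
        rw [Finset.sum_const, Finset.card_univ, nsmul_eq_mul]
    _ ≤ √((1 / 8) ^ 2) := Real.sqrt_le_sqrt card_mul_side_sq_le
    _ = 1 / 8 := Real.sqrt_sq (by norm_num)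

/-- The all-`½` vector, `‖½·𝟙‖`-bounded translation between `z_m` and the box coordinates. [folklore] -/
private def half : EuclideanSpace ℝ ι := WithLp.toLp 2 fun _ => (1 / 2 : ℝ)

omit [Fintype ι] in
/-- Coordinates of `½·𝟙`. [folklore] -/
@[simp]
private theorem half_apply (c : ι) : (half : EuclideanSpace ℝ ι) c = 1 / 2 := rfl

/-- `m = s⁻¹ z_m - ½·𝟙` as vectors of `ℝ^ι`. [folklore] -/
private theorem intVec_eq (m : ι → ℤ) : intVec m = (side ι)⁻¹ • center m - half := by
  ext c
  simp only [intVec_apply, PiLp.sub_apply, PiLp.smul_apply, center_apply, half_apply, smul_eq_mul]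
  field_simp [(side_pos (ι := ι)).ne']
  ring

/-- `1 + |m| ≤ A (1 + ‖z_m‖)` with `A = 1 + ‖½·𝟙‖ + s⁻¹`. [folklore] -/
private theorem one_add_norm_intVec_le (m : ι → ℤ) :
    1 + ‖intVec m‖ ≤ (1 + ‖(half : EuclideanSpace ℝ ι)‖ + (side ι)⁻¹) * (1 + ‖center m‖) := by
  have hs := side_pos (ι := ι)
  have hsi : 1 ≤ (side ι)⁻¹ := one_le_inv_iff₀.2 ⟨hs, side_le_one⟩
  have h1 : ‖intVec m‖ ≤ (side ι)⁻¹ * ‖center m‖ + ‖(half : EuclideanSpace ℝ ι)‖ := by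
    rw [intVec_eq]
    refine (norm_sub_le _ _).trans ?_
    rw [norm_smul, Real.norm_eq_abs, abs_of_pos (inv_pos.2 hs)]
  have h0 : 0 ≤ ‖(half : EuclideanSpace ℝ ι)‖ := norm_nonneg _
  have h2 : 0 ≤ ‖center m‖ := norm_nonneg _
  nlinarith

/-- If `‖x - z_m‖ ≤ 1/4` then `1 + ‖z_m‖ ≤ (5/4) (1 + ‖x‖)`. [folklore] -/
private theorem one_add_norm_center_le {m : ι → ℤ} {x : EuclideanSpace ℝ ι} (hx : ‖x - center m‖ ≤ 1 / 4) :
    1 + ‖center m‖ ≤ 5 / 4 * (1 + ‖x‖) := by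
  have : ‖center m‖ ≤ ‖x‖ + 1 / 4 := by
    calc ‖center m‖ = ‖x - (x - center m)‖ := by rw [sub_sub_cancel]
      _ ≤ ‖x‖ + ‖x - center m‖ := norm_sub_le _ _
      _ ≤ ‖x‖ + 1 / 4 := by linarith
  nlinarith [norm_nonneg x]

/-! ### The bump functions `χ_m` and the localisation maps -/

variable (ι) in
/-- A smooth bump on `ℝ^ι` centred at `0`, equal to `1` on the ball of radius `1/8` and supported
in the ball of radius `1/4` (Mathlib's `ContDiffBump`). [folklore] -/
private def bump : ContDiffBump (0 : EuclideanSpace ℝ ι) := ⟨1 / 8, 1 / 4, by norm_num, by norm_num⟩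

variable (ι) in
/-- The bump as a Schwartz function. [folklore] -/
private def bumpSchwartz : 𝓢(EuclideanSpace ℝ ι, ℝ) :=
  (bump ι).hasCompactSupport.toSchwartzMap (bump ι).contDiff

/-- The bump as a Schwartz function has the same values. [folklore] -/
@[simp]
private theorem bumpSchwartz_apply (x : EuclideanSpace ℝ ι) : bumpSchwartz ι x = bump ι x := rfl

/-- The translated bump `χ_m (x) = χ (x - z_m)`, a Schwartz function. [folklore] -/
private def cutoff (m : ι → ℤ) : 𝓢(EuclideanSpace ℝ ι, ℝ) :=
  SchwartzMap.compSubConstCLM ℝ (center m) (bumpSchwartz ι)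

/-- `χ_m x = χ (x - z_m)`. [folklore] -/
private theorem cutoff_apply (m : ι → ℤ) (x : EuclideanSpace ℝ ι) : cutoff m x = bump ι (x - center m) := rfl

/-- `χ_m = χ (· - z_m)` as functions. [folklore] -/
private theorem coe_cutoff (m : ι → ℤ) :
    (cutoff m : EuclideanSpace ℝ ι → ℝ) = fun x => bumpSchwartz ι (x - center m) := rfl

/-- `χ_m = 1` on the ball of radius `1/8` about `z_m` (in particular on the cube `Q_m`). [folklore] -/
private theorem cutoff_eq_one {m : ι → ℤ} {x : EuclideanSpace ℝ ι} (hx : ‖x - center m‖ ≤ 1 / 8) :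
    cutoff m x = 1 := by
  rw [cutoff_apply]
  exact (bump ι).one_of_mem_closedBall (by simpa [bump] using hx)

/-- `χ_m = 0` off the ball of radius `1/4` about `z_m`. [folklore] -/
private theorem cutoff_eq_zero {m : ι → ℤ} {x : EuclideanSpace ℝ ι} (hx : 1 / 4 ≤ ‖x - center m‖) :
    cutoff m x = 0 := by
  rw [cutoff_apply]
  exact (bump ι).zero_of_le_dist (by simpa [bump] using hx)

/-- `χ_m x ≠ 0 → ‖x - z_m‖ < 1/4`. [folklore] -/
private theorem norm_sub_center_lt_of_cutoff_ne_zero {m : ι → ℤ} {x : EuclideanSpace ℝ ι}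
    (hx : cutoff m x ≠ 0) : ‖x - center m‖ < 1 / 4 := by
  by_contra h
  exact hx (cutoff_eq_zero (not_lt.1 h))

/-- `tsupport χ_m ⊆ B̄(z_m, 1/4)`. [folklore] -/
private theorem tsupport_cutoff_subset (m : ι → ℤ) :
    tsupport (cutoff m : EuclideanSpace ℝ ι → ℝ) ⊆ closedBall (center m) (1 / 4) := by
  refine closure_minimal (fun x hx => ?_) isClosed_closedBall
  rw [mem_closedBall, dist_eq_norm]
  exact (norm_sub_center_lt_of_cutoff_ne_zero hx).le

/-- The derivatives of `χ_m` are bounded uniformly in `m` (translation invariance). [folklore] -/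
private theorem norm_iteratedFDeriv_cutoff_le (m : ι → ℤ) (i : ℕ) (x : EuclideanSpace ℝ ι) :
    ‖iteratedFDeriv ℝ i (cutoff m : EuclideanSpace ℝ ι → ℝ) x‖ ≤
      SchwartzMap.seminorm ℝ 0 i (bumpSchwartz ι) := by
  rw [coe_cutoff, iteratedFDeriv_comp_sub]
  exact SchwartzMap.norm_iteratedFDeriv_le_seminorm ℝ _ i _

/-- The localisation map `f ↦ χ_m • f` on `𝓢(ℝ^ι, ℂ)` (real-linear, continuous). [folklore] -/
private def cut (m : ι → ℤ) : 𝓢(EuclideanSpace ℝ ι, ℂ) →L[ℝ] 𝓢(EuclideanSpace ℝ ι, ℂ) :=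
  SchwartzMap.smulLeftCLM ℂ (cutoff m : EuclideanSpace ℝ ι → ℝ)

/-- `(χ_m • f) x = χ_m x • f x`. [folklore] -/
@[simp]
private theorem cut_apply (m : ι → ℤ) (f : 𝓢(EuclideanSpace ℝ ι, ℂ)) (x : EuclideanSpace ℝ ι) :
    cut m f x = cutoff m x • f x :=
  SchwartzMap.smulLeftCLM_apply_apply (cutoff m).hasTemperateGrowth f x

/-- `χ_m • f = fun x => χ_m x • f x` as functions. [folklore] -/
private theorem coe_cut (m : ι → ℤ) (f : 𝓢(EuclideanSpace ℝ ι, ℂ)) :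
    (cut m f : EuclideanSpace ℝ ι → ℂ) = fun x => cutoff m x • f x :=
  funext (cut_apply m f)

/-- `tsupport (χ_m • f) ⊆ B̄(z_m, 1/4)`. [folklore] -/
private theorem tsupport_cut_subset (m : ι → ℤ) (f : 𝓢(EuclideanSpace ℝ ι, ℂ)) :
    tsupport (cut m f : EuclideanSpace ℝ ι → ℂ) ⊆ closedBall (center m) (1 / 4) := by
  rw [coe_cut]
  exact (tsupport_smul_subset_left _ _).trans (tsupport_cutoff_subset m)

/-- The Fourier transform evaluated at a point, `f ↦ 𝓕f(ξ)`, as a real-linear continuous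
functional on `𝓢(ℝ^ι, ℂ)`. [folklore] -/
private def fourierEval (ξ : EuclideanSpace ℝ ι) : 𝓢(EuclideanSpace ℝ ι, ℂ) →L[ℝ] ℂ :=
  (BoundedContinuousFunction.evalCLM ℝ ξ).comp
    ((SchwartzMap.toBoundedContinuousFunctionCLM ℝ (EuclideanSpace ℝ ι) ℂ).comp
      (SchwartzMap.fourierTransformCLM ℝ))

/-- `fourierEval ξ f = 𝓕f(ξ)`. [folklore] -/
@[simp]
private theorem fourierEval_apply (ξ : EuclideanSpace ℝ ι) (f : 𝓢(EuclideanSpace ℝ ι, ℂ)) :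
    fourierEval ξ f = 𝓕 (f : EuclideanSpace ℝ ι → ℂ) ξ := rfl

/-! ### The functionals `φ_{m,n}` -/

/-- The weight `(1 + ‖z_m‖)^k`. [folklore] -/
private def weight (k : ℕ) (m : ι → ℤ) : ℝ := (1 + ‖center m‖) ^ k

/-- `0 < (1 + ‖z_m‖)^k`. [folklore] -/
private theorem weight_pos (k : ℕ) (m : ι → ℤ) : 0 < weight k m := by
  unfold weight; positivity

/-- Real parts: `φ⁽¹⁾_{m,n}(f) = (1 + ‖z_m‖)^k · Re 𝓕(χ_m f)(n)`. [folklore] -/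
private def phiRe (k : ℕ) (a : (ι → ℤ) × (ι → ℤ)) : 𝓢(EuclideanSpace ℝ ι, ℂ) →L[ℝ] ℝ :=
  weight k a.1 • (Complex.reCLM.comp ((fourierEval (intVec a.2)).comp (cut a.1)))

/-- Imaginary parts: `φ⁽²⁾_{m,n}(f) = (1 + ‖z_m‖)^k · Im 𝓕(χ_m f)(n)`. [folklore] -/
private def phiIm (k : ℕ) (a : (ι → ℤ) × (ι → ℤ)) : 𝓢(EuclideanSpace ℝ ι, ℂ) →L[ℝ] ℝ :=
  weight k a.1 • (Complex.imCLM.comp ((fourierEval (intVec a.2)).comp (cut a.1)))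

/-- The whole countable family of functionals. [folklore] -/
private def phi (k : ℕ) : ((ι → ℤ) × (ι → ℤ)) ⊕ ((ι → ℤ) × (ι → ℤ)) →
    𝓢(EuclideanSpace ℝ ι, ℂ) →L[ℝ] ℝ :=
  Sum.elim (phiRe k) (phiIm k)

/-- The first summand of the family consists of the real parts. [folklore] -/
@[simp]
private theorem phi_inl (k : ℕ) (a : (ι → ℤ) × (ι → ℤ)) : phi (ι := ι) k (Sum.inl a) = phiRe k a := rfl

/-- The second summand of the family consists of the imaginary parts. [folklore] -/
@[simp]
private theorem phi_inr (k : ℕ) (a : (ι → ℤ) × (ι → ℤ)) : phi (ι := ι) k (Sum.inr a) = phiIm k a := rfl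

/-- `φ⁽¹⁾_{m,n}(f) = (1 + ‖z_m‖)^k Re 𝓕(χ_m f)(n)`. [folklore] -/
private theorem phiRe_apply (k : ℕ) (a : (ι → ℤ) × (ι → ℤ)) (f : 𝓢(EuclideanSpace ℝ ι, ℂ)) :
    phiRe k a f = weight k a.1 * (𝓕 (cut a.1 f : EuclideanSpace ℝ ι → ℂ) (intVec a.2)).re := by
  simp [phiRe]

/-- `φ⁽²⁾_{m,n}(f) = (1 + ‖z_m‖)^k Im 𝓕(χ_m f)(n)`. [folklore] -/
private theorem phiIm_apply (k : ℕ) (a : (ι → ℤ) × (ι → ℤ)) (f : 𝓢(EuclideanSpace ℝ ι, ℂ)) :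
    phiIm k a f = weight k a.1 * (𝓕 (cut a.1 f : EuclideanSpace ℝ ι → ℂ) (intVec a.2)).im := by
  simp [phiIm]

/-- `|φ⁽¹⁾_{m,n}(f)| ≤ (1 + ‖z_m‖)^k |𝓕(χ_m f)(n)|`. [folklore] -/
private theorem norm_phiRe_le (k : ℕ) (a : (ι → ℤ) × (ι → ℤ)) (f : 𝓢(EuclideanSpace ℝ ι, ℂ)) :
    ‖phiRe k a f‖ ≤ weight k a.1 * ‖𝓕 (cut a.1 f : EuclideanSpace ℝ ι → ℂ) (intVec a.2)‖ := by
  rw [phiRe_apply, Real.norm_eq_abs, abs_mul, abs_of_pos (weight_pos k a.1)]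
  exact mul_le_mul_of_nonneg_left (Complex.abs_re_le_norm _) (weight_pos k a.1).le

/-- `|φ⁽²⁾_{m,n}(f)| ≤ (1 + ‖z_m‖)^k |𝓕(χ_m f)(n)|`. [folklore] -/
private theorem norm_phiIm_le (k : ℕ) (a : (ι → ℤ) × (ι → ℤ)) (f : 𝓢(EuclideanSpace ℝ ι, ℂ)) :
    ‖phiIm k a f‖ ≤ weight k a.1 * ‖𝓕 (cut a.1 f : EuclideanSpace ℝ ι → ℂ) (intVec a.2)‖ := by
  rw [phiIm_apply, Real.norm_eq_abs, abs_mul, abs_of_pos (weight_pos k a.1)]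
  exact mul_le_mul_of_nonneg_left (Complex.abs_im_le_norm _) (weight_pos k a.1).le

/-- `(1 + ‖z_m‖)^k |𝓕(χ_m f)(n)| ≤ |φ⁽¹⁾_{m,n}(f)| + |φ⁽²⁾_{m,n}(f)|` (`|z| ≤ |Re z| + |Im z|`). [folklore] -/
private theorem weight_mul_norm_le (k : ℕ) (a : (ι → ℤ) × (ι → ℤ)) (f : 𝓢(EuclideanSpace ℝ ι, ℂ)) :
    weight k a.1 * ‖𝓕 (cut a.1 f : EuclideanSpace ℝ ι → ℂ) (intVec a.2)‖ ≤
      ‖phiRe k a f‖ + ‖phiIm k a f‖ := by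
  rw [phiRe_apply, phiIm_apply, Real.norm_eq_abs, Real.norm_eq_abs, abs_mul, abs_mul,
    abs_of_pos (weight_pos k a.1), ← mul_add]
  exact mul_le_mul_of_nonneg_left (Complex.norm_le_abs_re_add_abs_im _) (weight_pos k a.1).le


/-! ### The Fourier side: decay of `𝓕` on `𝓢`, uniformly in finitely many Schwartz seminorms -/

/-- Continuity of the Fourier transform on `𝓢(ℝ^ι, ℂ)` in quantitative form: for every `N`
there are `a₀, b₀, C` with `(1 + ‖ξ‖)^N ‖𝓕G(ξ)‖ ≤ C sup_{a ≤ a₀, b ≤ b₀} p_{a,b}(G)`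
(`Seminorm.bound_of_continuous` applied to `p_{N,0} ∘ 𝓕`). [folklore] -/
theorem exists_fourier_decay (N : ℕ) : ∃ (a₀ b₀ : ℕ) (C : ℝ), 0 ≤ C ∧
    ∀ (G : 𝓢(EuclideanSpace ℝ ι, ℂ)) (ξ : EuclideanSpace ℝ ι),
      (1 + ‖ξ‖) ^ N * ‖𝓕 (G : EuclideanSpace ℝ ι → ℂ) ξ‖ ≤
        C * (Finset.Iic (a₀, b₀)).sup (schwartzSeminormFamily ℝ (EuclideanSpace ℝ ι) ℂ) G := by
  set Q : Seminorm ℝ 𝓢(EuclideanSpace ℝ ι, ℂ) :=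
    ((Finset.Iic (N, 0)).sup (schwartzSeminormFamily ℝ (EuclideanSpace ℝ ι) ℂ)).comp
      (SchwartzMap.fourierTransformCLM ℝ :
        𝓢(EuclideanSpace ℝ ι, ℂ) →L[ℝ] 𝓢(EuclideanSpace ℝ ι, ℂ)).toLinearMap with hQ_def
  have hQ : Continuous Q := by
    rw [hQ_def, Seminorm.coe_comp]
    exact (Seminorm.continuous_finsetSup fun i _ =>
      (schwartz_withSeminorms ℝ (EuclideanSpace ℝ ι) ℂ).continuous_seminorm i).comp
        (SchwartzMap.fourierTransformCLM ℝ).continuous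
  obtain ⟨s₀, C₀, -, hle⟩ := Seminorm.bound_of_continuous
    (schwartz_withSeminorms ℝ (EuclideanSpace ℝ ι) ℂ) Q hQ
  have hsub : s₀ ⊆ Finset.Iic (s₀.sup Prod.fst, s₀.sup Prod.snd) := fun i hi =>
    Finset.mem_Iic.2 ⟨Finset.le_sup (f := Prod.fst) hi, Finset.le_sup (f := Prod.snd) hi⟩
  refine ⟨s₀.sup Prod.fst, s₀.sup Prod.snd, 2 ^ N * C₀, by positivity, fun G ξ => ?_⟩
  have h1 := SchwartzMap.one_add_le_sup_seminorm_apply (𝕜 := ℝ) (m := (N, 0)) (k := N) (n := 0)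
    le_rfl le_rfl (𝓕 G) ξ
  rw [norm_iteratedFDeriv_zero] at h1
  have h2 : (Finset.Iic (N, 0)).sup (fun m => SchwartzMap.seminorm ℝ m.1 m.2) (𝓕 G) = Q G := rfl
  have h3 : Q G ≤ C₀ * (Finset.Iic (s₀.sup Prod.fst, s₀.sup Prod.snd)).sup
      (schwartzSeminormFamily ℝ (EuclideanSpace ℝ ι) ℂ) G := by
    refine (hle G).trans ?_
    rw [smul_apply, NNReal.smul_def, smul_eq_mul]
    exact mul_le_mul_of_nonneg_left (Seminorm.le_def.1 (Finset.sup_mono hsub) G) C₀.2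
  calc (1 + ‖ξ‖) ^ N * ‖𝓕 (G : EuclideanSpace ℝ ι → ℂ) ξ‖
      = (1 + ‖ξ‖) ^ N * ‖(𝓕 G : 𝓢(EuclideanSpace ℝ ι, ℂ)) ξ‖ := rfl
    _ ≤ 2 ^ N * Q G := h2 ▸ h1
    _ ≤ 2 ^ N * (C₀ * (Finset.Iic (s₀.sup Prod.fst, s₀.sup Prod.snd)).sup
          (schwartzSeminormFamily ℝ (EuclideanSpace ℝ ι) ℂ) G) := by gcongr
    _ = 2 ^ N * C₀ * (Finset.Iic (s₀.sup Prod.fst, s₀.sup Prod.snd)).sup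
          (schwartzSeminormFamily ℝ (EuclideanSpace ℝ ι) ℂ) G := by ring

/-! ### Localisation: Schwartz seminorms of `χ_m f` decay in `m` -/

/-- **Leibniz + support estimate.** For `a ≤ a₀`, `b ≤ b₀`:
`p_{a,b}(χ_m f) ≤ K (1 + ‖z_m‖)^{-M} sup_{a' ≤ a₀ + M, b' ≤ b₀} p_{a',b'}(f)`, with `K`
independent of `m` — the derivatives of `χ_m` are bounded uniformly in `m`, `χ_m f` is supported
in `B̄(z_m, 1/4)`, and there `(1 + ‖x‖)^{-M} ≤ (5/4)^M (1 + ‖z_m‖)^{-M}`. [folklore] -/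
private theorem exists_seminorm_cut_le (a₀ b₀ M : ℕ) : ∃ K : ℝ, 0 ≤ K ∧
    ∀ (m : ι → ℤ) (f : 𝓢(EuclideanSpace ℝ ι, ℂ)) {a b : ℕ}, a ≤ a₀ → b ≤ b₀ →
      SchwartzMap.seminorm ℝ a b (cut m f) ≤
        K * ((1 + ‖center m‖) ^ M)⁻¹ *
          (Finset.Iic (a₀ + M, b₀)).sup (schwartzSeminormFamily ℝ (EuclideanSpace ℝ ι) ℂ) f := by
  set B : ℝ := ∑ i ∈ Finset.range (b₀ + 1), SchwartzMap.seminorm ℝ 0 i (bumpSchwartz ι) with hB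
  have hB0 : 0 ≤ B := Finset.sum_nonneg fun _ _ => apply_nonneg _ _
  have hBi : ∀ i ≤ b₀, SchwartzMap.seminorm ℝ 0 i (bumpSchwartz ι) ≤ B := fun i hi =>
    Finset.single_le_sum (f := fun i => SchwartzMap.seminorm ℝ 0 i (bumpSchwartz ι))
      (fun _ _ => apply_nonneg _ _) (Finset.mem_range.2 (Nat.lt_succ_of_le hi))
  refine ⟨2 ^ b₀ * B * 2 ^ (a₀ + M) * (5 / 4) ^ M, by positivity, fun m f a b ha hb => ?_⟩
  set P := (Finset.Iic (a₀ + M, b₀)).sup (schwartzSeminormFamily ℝ (EuclideanSpace ℝ ι) ℂ)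
    with hP
  refine SchwartzMap.seminorm_le_bound ℝ a b _ (by positivity) fun x => ?_
  by_cases hx : ‖x - center m‖ ≤ 1 / 4
  · -- inside the support ball: Leibniz rule
    have hL := norm_iteratedFDeriv_smul_le (𝕜 := ℝ) ((cutoff m).smooth ⊤) (f.smooth ⊤) x
      (n := b) (mod_cast le_top)
    rw [← coe_cut] at hL
    have hz : ((1 + ‖x‖) ^ M)⁻¹ ≤ (5 / 4) ^ M * ((1 + ‖center m‖) ^ M)⁻¹ := by
      have h1 : (1 + ‖center m‖) ^ M ≤ (5 / 4) ^ M * (1 + ‖x‖) ^ M := by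
        rw [← mul_pow]
        exact pow_le_pow_left₀ (by positivity) (one_add_norm_center_le hx) M
      rw [← div_eq_mul_inv, le_div_iff₀ (by positivity), inv_mul_eq_div,
        div_le_iff₀ (by positivity)]
      linarith
    have hterm : ∀ i ∈ Finset.range (b + 1),
        ‖x‖ ^ a * ((b.choose i : ℝ) * ‖iteratedFDeriv ℝ i (cutoff m : EuclideanSpace ℝ ι → ℝ) x‖ *
          ‖iteratedFDeriv ℝ (b - i) (f : EuclideanSpace ℝ ι → ℂ) x‖) ≤
          (b.choose i : ℝ) * (B * 2 ^ (a₀ + M) * (5 / 4) ^ M * ((1 + ‖center m‖) ^ M)⁻¹ * P f) := by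
      intro i hi
      have hi' : i ≤ b := Nat.lt_succ_iff.1 (Finset.mem_range.1 hi)
      have hχ : ‖iteratedFDeriv ℝ i (cutoff m : EuclideanSpace ℝ ι → ℝ) x‖ ≤ B :=
        (norm_iteratedFDeriv_cutoff_le m i x).trans (hBi i (hi'.trans hb))
      have hf1 := SchwartzMap.one_add_le_sup_seminorm_apply (𝕜 := ℝ) (m := (a₀ + M, b₀))
        (k := a₀ + M) (n := b - i) le_rfl (by simp only; omega) f x
      have hxa : ‖x‖ ^ a ≤ (1 + ‖x‖) ^ (a₀ + M) * ((1 + ‖x‖) ^ M)⁻¹ := by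
        rw [pow_add, mul_assoc, mul_inv_cancel₀ (by positivity), mul_one]
        exact (pow_le_pow_left₀ (norm_nonneg _) (by linarith [norm_nonneg x]) a).trans
          (pow_le_pow_right₀ (by linarith [norm_nonneg x]) ha)
      have hf2 : ‖x‖ ^ a * ‖iteratedFDeriv ℝ (b - i) (f : EuclideanSpace ℝ ι → ℂ) x‖ ≤
          2 ^ (a₀ + M) * (5 / 4) ^ M * ((1 + ‖center m‖) ^ M)⁻¹ * P f := by
        calc ‖x‖ ^ a * ‖iteratedFDeriv ℝ (b - i) (f : EuclideanSpace ℝ ι → ℂ) x‖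
            ≤ (1 + ‖x‖) ^ (a₀ + M) * ((1 + ‖x‖) ^ M)⁻¹ *
                ‖iteratedFDeriv ℝ (b - i) (f : EuclideanSpace ℝ ι → ℂ) x‖ := by gcongr
          _ = ((1 + ‖x‖) ^ M)⁻¹ * ((1 + ‖x‖) ^ (a₀ + M) *
                ‖iteratedFDeriv ℝ (b - i) (f : EuclideanSpace ℝ ι → ℂ) x‖) := by ring
          _ ≤ ((5 / 4) ^ M * ((1 + ‖center m‖) ^ M)⁻¹) * (2 ^ (a₀ + M) * P f) :=
                mul_le_mul hz hf1 (by positivity) (by positivity)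
          _ = _ := by ring
      calc ‖x‖ ^ a * ((b.choose i : ℝ) * ‖iteratedFDeriv ℝ i (cutoff m : EuclideanSpace ℝ ι → ℝ) x‖ *
            ‖iteratedFDeriv ℝ (b - i) (f : EuclideanSpace ℝ ι → ℂ) x‖)
          = (b.choose i : ℝ) * ‖iteratedFDeriv ℝ i (cutoff m : EuclideanSpace ℝ ι → ℝ) x‖ *
              (‖x‖ ^ a * ‖iteratedFDeriv ℝ (b - i) (f : EuclideanSpace ℝ ι → ℂ) x‖) := by ring
        _ ≤ (b.choose i : ℝ) * B *
              (2 ^ (a₀ + M) * (5 / 4) ^ M * ((1 + ‖center m‖) ^ M)⁻¹ * P f) := by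
            gcongr
        _ = _ := by ring
    calc ‖x‖ ^ a * ‖iteratedFDeriv ℝ b (cut m f : EuclideanSpace ℝ ι → ℂ) x‖
        ≤ ‖x‖ ^ a * ∑ i ∈ Finset.range (b + 1), (b.choose i : ℝ) *
            ‖iteratedFDeriv ℝ i (cutoff m : EuclideanSpace ℝ ι → ℝ) x‖ *
            ‖iteratedFDeriv ℝ (b - i) (f : EuclideanSpace ℝ ι → ℂ) x‖ := by gcongr
      _ = ∑ i ∈ Finset.range (b + 1), ‖x‖ ^ a * ((b.choose i : ℝ) *
            ‖iteratedFDeriv ℝ i (cutoff m : EuclideanSpace ℝ ι → ℝ) x‖ *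
            ‖iteratedFDeriv ℝ (b - i) (f : EuclideanSpace ℝ ι → ℂ) x‖) := Finset.mul_sum _ _ _
      _ ≤ ∑ i ∈ Finset.range (b + 1), (b.choose i : ℝ) *
            (B * 2 ^ (a₀ + M) * (5 / 4) ^ M * ((1 + ‖center m‖) ^ M)⁻¹ * P f) :=
          Finset.sum_le_sum hterm
      _ = (2 : ℝ) ^ b * (B * 2 ^ (a₀ + M) * (5 / 4) ^ M * ((1 + ‖center m‖) ^ M)⁻¹ * P f) := by
          rw [← Finset.sum_mul]
          congr 1
          have := Nat.sum_range_choose b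
          exact_mod_cast this
      _ ≤ (2 : ℝ) ^ b₀ * (B * 2 ^ (a₀ + M) * (5 / 4) ^ M * ((1 + ‖center m‖) ^ M)⁻¹ * P f) := by
          gcongr
          · norm_num
      _ = _ := by ring
  · -- outside the support ball: the derivative vanishes
    have hx' : x ∉ tsupport (cut m f : EuclideanSpace ℝ ι → ℂ) := fun h => hx (by
      have := tsupport_cut_subset m f h
      rwa [mem_closedBall, dist_eq_norm] at this)
    have h0 : iteratedFDeriv ℝ b (cut m f : EuclideanSpace ℝ ι → ℂ) x = 0 :=
      notMem_support.1 fun h => hx' (support_iteratedFDeriv_subset b h)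
    rw [h0, norm_zero, mul_zero]
    positivity

/-! ### Domination of the functionals by a summable sequence times a continuous seminorm -/

/-- **Domination.** There are a continuous seminorm `q` on `𝓢(ℝ^ι, ℂ)` and a summable family
`c ≥ 0` with `‖φ_a(f)‖ ≤ c_a q(f)` for all `a` and `f`; here
`c_{m,n} ≍ (1 + ‖z_m‖)^{-2d} (1 + |n|)^{-2d}`. [folklore] -/
private theorem exists_dominating (k : ℕ) :
    ∃ q : Seminorm ℝ 𝓢(EuclideanSpace ℝ ι, ℂ), Continuous q ∧
      ∃ c : ((ι → ℤ) × (ι → ℤ)) ⊕ ((ι → ℤ) × (ι → ℤ)) → ℝ≥0, Summable c ∧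
        ∀ a f, ‖phi k a f‖ ≤ c a * q f := by
  set N : ℕ := 2 * Fintype.card ι with hN
  obtain ⟨a₀, b₀, C, hC0, hC⟩ := exists_fourier_decay (ι := ι) N
  obtain ⟨K, hK0, hK⟩ := exists_seminorm_cut_le (ι := ι) a₀ b₀ (k + N)
  set P : Seminorm ℝ 𝓢(EuclideanSpace ℝ ι, ℂ) :=
    (Finset.Iic (a₀ + (k + N), b₀)).sup (schwartzSeminormFamily ℝ (EuclideanSpace ℝ ι) ℂ)
    with hP
  have hPc : Continuous P := Seminorm.continuous_finsetSup fun i _ =>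
    (schwartz_withSeminorms ℝ (EuclideanSpace ℝ ι) ℂ).continuous_seminorm i
  -- the majorant
  set u : (ι → ℤ) → ℝ := fun m => ((1 + ‖center m‖) ^ N)⁻¹ with hu
  set v : (ι → ℤ) → ℝ := fun n => ((1 + ‖intVec n‖) ^ N)⁻¹ with hv
  have hu0 : ∀ m, 0 ≤ u m := fun m => by positivity
  have hv0 : ∀ n, 0 ≤ v n := fun n => by positivity
  have hvs : Summable v := by
    refine Summable.of_nonneg_of_le hv0 (fun n => ?_) (summable_pi_inv_one_add_abs_sq (ι := ι))
    rw [Finset.prod_inv_distrib]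
    have h := prod_one_add_abs_sq_le n
    rw [← hN] at h
    exact inv_anti₀ (Finset.prod_pos fun c _ => by positivity) h
  have hus : Summable u := by
    set A : ℝ := 1 + ‖(half : EuclideanSpace ℝ ι)‖ + (side ι)⁻¹ with hA
    have hA0 : 0 ≤ A := by
      have := side_pos (ι := ι)
      positivity
    refine Summable.of_nonneg_of_le hu0 (fun m => ?_) (hvs.mul_left (A ^ N))
    have h1 : (1 + ‖intVec m‖) ^ N ≤ A ^ N * (1 + ‖center m‖) ^ N := by
      rw [← mul_pow]
      exact pow_le_pow_left₀ (by positivity) (one_add_norm_intVec_le m) N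
    simp only [hu, hv]
    rw [← div_eq_mul_inv, le_div_iff₀ (by positivity), inv_mul_eq_div, div_le_iff₀ (by positivity)]
    linarith
  set g : (ι → ℤ) × (ι → ℤ) → ℝ := fun a => C * K * (u a.1 * v a.2) with hg
  have hg0 : ∀ a, 0 ≤ g a := fun a => by positivity
  have hgs : Summable g := (hus.mul_of_nonneg hvs hu0 hv0).mul_left (C * K)
  -- the key estimate
  have key : ∀ (m n : ι → ℤ) (f : 𝓢(EuclideanSpace ℝ ι, ℂ)),
      weight k m * ‖𝓕 (cut m f : EuclideanSpace ℝ ι → ℂ) (intVec n)‖ ≤ g (m, n) * P f := by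
    intro m n f
    have h1 := hC (cut m f) (intVec n)
    have h2 : (Finset.Iic (a₀, b₀)).sup (schwartzSeminormFamily ℝ (EuclideanSpace ℝ ι) ℂ)
        (cut m f) ≤ K * ((1 + ‖center m‖) ^ (k + N))⁻¹ * P f :=
      Seminorm.finset_sup_apply_le (by positivity) fun i hi =>
        hK m f (Finset.mem_Iic.1 hi).1 (Finset.mem_Iic.1 hi).2
    have hvpos : 0 < (1 + ‖intVec n‖) ^ N := by positivity
    have h3 : ‖𝓕 (cut m f : EuclideanSpace ℝ ι → ℂ) (intVec n)‖ ≤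
        v n * (C * (K * ((1 + ‖center m‖) ^ (k + N))⁻¹ * P f)) := by
      simp only [hv]
      rw [inv_mul_eq_div, le_div_iff₀ hvpos, mul_comm]
      exact h1.trans (mul_le_mul_of_nonneg_left h2 hC0)
    have h4 : weight k m * ((1 + ‖center m‖) ^ (k + N))⁻¹ = u m := by
      simp only [hu, weight]
      rw [pow_add, mul_inv, ← mul_assoc, mul_inv_cancel₀ (by positivity), one_mul]
    calc weight k m * ‖𝓕 (cut m f : EuclideanSpace ℝ ι → ℂ) (intVec n)‖
        ≤ weight k m * (v n * (C * (K * ((1 + ‖center m‖) ^ (k + N))⁻¹ * P f))) :=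
          mul_le_mul_of_nonneg_left h3 (weight_pos k m).le
      _ = C * K * ((weight k m * ((1 + ‖center m‖) ^ (k + N))⁻¹) * v n) * P f := by ring
      _ = g (m, n) * P f := by rw [h4]
  refine ⟨P, hPc, Sum.elim (fun a => ⟨g a, hg0 a⟩) (fun a => ⟨g a, hg0 a⟩), ?_, ?_⟩
  · refine Summable.sum _ ?_ ?_
    · simp only [Sum.elim_comp_inl]
      exact NNReal.summable_coe.1 hgs
    · simp only [Sum.elim_comp_inr]
      exact NNReal.summable_coe.1 hgs
  · rintro (a | a) f
    · simp only [phi_inl]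
      exact (norm_phiRe_le k a f).trans (key a.1 a.2 f)
    · simp only [phi_inr]
      exact (norm_phiIm_le k a f).trans (key a.1 a.2 f)

/-! ### The lower bound: `‖x‖^k |f(x)| ≤ ∑ₐ |φₐ(f)|` by the Fourier expansion in the box of `x` -/

/-- A translation changes the Fourier transform only by a phase: the box Fourier coefficients
in the translated unit box have the same moduli as the values `𝓕G(n)`, `n ∈ ℤ^ι`. [folklore] -/
theorem norm_boxCoeff_refl (w : EuclideanSpace ℝ ι) (G : 𝓢(EuclideanSpace ℝ ι, ℂ)) (n : ι → ℤ) :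
    ‖boxCoeff (ContinuousLinearEquiv.refl ℝ (EuclideanSpace ℝ ι)) w G n‖ =
      ‖𝓕 (G : EuclideanSpace ℝ ι → ℂ) (intVec n)‖ := by
  have e1 : (toCube (ContinuousLinearEquiv.refl ℝ (EuclideanSpace ℝ ι)) w G :
      EuclideanSpace ℝ ι → ℂ) = (G : EuclideanSpace ℝ ι → ℂ) ∘ fun y => y + -w := by
    funext y
    simp [toCube_apply, sub_eq_add_neg]
  unfold boxCoeff
  rw [e1]
  change ‖VectorFourier.fourierIntegral 𝐞 volume (innerₗ (EuclideanSpace ℝ ι))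
      ((G : EuclideanSpace ℝ ι → ℂ) ∘ fun y => y + -w) (intVec n)‖ =
    ‖VectorFourier.fourierIntegral 𝐞 volume (innerₗ (EuclideanSpace ℝ ι))
      (G : EuclideanSpace ℝ ι → ℂ) (intVec n)‖
  rw [VectorFourier.fourierIntegral_comp_add_right]
  exact Circle.norm_smul _ _

/-- **Fourier series bound in a box.** If `G ∈ 𝓢(ℝ^ι)` vanishes off the open ball of radius
`1/4` about `z`, then `|G(x)| ≤ ∑_{n ∈ ℤ^ι} |𝓕G(n)|` for `‖x - z‖ ≤ 1/4`: `G` is the sum of its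
Fourier series in the unit box centred at `z`, whose coefficients have moduli `|𝓕G(n)|`.
[folklore] -/
theorem norm_le_tsum_norm_fourier {G : 𝓢(EuclideanSpace ℝ ι, ℂ)} {z : EuclideanSpace ℝ ι}
    (hG : ∀ v, G v ≠ 0 → ‖v - z‖ < 1 / 4) {x : EuclideanSpace ℝ ι} (hx : ‖x - z‖ ≤ 1 / 4) :
    ‖G x‖ ≤ ∑' n : ι → ℤ, ‖𝓕 (G : EuclideanSpace ℝ ι → ℂ) (intVec n)‖ := by
  set w : EuclideanSpace ℝ ι := half - z with hw_def
  set L := ContinuousLinearEquiv.refl ℝ (EuclideanSpace ℝ ι) with hL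
  have hcoord : ∀ v : EuclideanSpace ℝ ι, ∀ c, (L v + w) c = (v - z) c + 1 / 2 := by
    intro v c
    simp only [hL, hw_def, ContinuousLinearEquiv.refl_apply, PiLp.add_apply, PiLp.sub_apply,
      half_apply]
    ring
  have hGsupp : ∀ v, G v ≠ 0 → ∀ c, (L v + w) c ∈ Icc (1 / 4 : ℝ) (1 - 1 / 4) := by
    intro v hv c
    have h2 : |(v - z) c| < 1 / 4 :=
      lt_of_le_of_lt (by simpa using PiLp.norm_apply_le (v - z) c) (hG v hv)
    rw [hcoord, mem_Icc]
    rw [abs_lt] at h2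
    constructor <;> linarith [h2.1, h2.2]
  have hxbox : ∀ c, (L x + w) c ∈ Icc (0 : ℝ) 1 := by
    intro c
    have h2 : |(x - z) c| ≤ 1 / 4 := le_trans (by simpa using PiLp.norm_apply_le (x - z) c) hx
    rw [hcoord, mem_Icc]
    rw [abs_le] at h2
    constructor <;> linarith [h2.1, h2.2]
  have hsum := hasSum_boxCoeff_mul_eChar L w G (δ := 1 / 4) (by norm_num) hGsupp x hxbox
  have hsn : Summable fun n : ι → ℤ => ‖boxCoeff L w G n‖ := by
    simpa using summable_norm_boxCoeff_mul_pow L w G 0 (le_refl (0 : ℝ))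
  rw [← hsum.tsum_eq]
  refine (norm_tsum_le_tsum_norm ?_).trans (le_of_eq (tsum_congr fun n => ?_))
  · refine hsn.congr fun n => ?_
    rw [norm_mul, norm_eChar, mul_one]
  · rw [norm_mul, norm_eChar, mul_one, hL, norm_boxCoeff_refl]

/-- **Pointwise lower bound.** For `x` in the lattice cube `Q_m`, `f(x) = (χ_m f)(x)` is the sum
of its Fourier series in the unit box around `z_m`, whose coefficients have modulus
`|𝓕(χ_m f)(n)|`; with `‖x‖^k ≤ (1 + ‖z_m‖)^k` this gives `‖x‖^k |f(x)| ≤ ∑ₐ |φₐ(f)|`.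
[folklore] -/
private theorem pow_mul_norm_le_tsum (k : ℕ) (f : 𝓢(EuclideanSpace ℝ ι, ℂ))
    (hs : Summable fun a => ‖phi k a f‖) (x : EuclideanSpace ℝ ι) :
    ‖x‖ ^ k * ‖f x‖ ≤ ∑' a, ‖phi k a f‖ := by
  set m := cubeIndex x with hm
  have hxm : ‖x - center m‖ ≤ 1 / 8 := norm_sub_center_cubeIndex_le x
  -- (1) `(χ_m f) x = f x`
  have hGx : cut m f x = f x := by rw [cut_apply, cutoff_eq_one hxm, one_smul]
  -- (2) the weight
  have hw : ‖x‖ ^ k ≤ weight k m := by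
    unfold weight
    refine pow_le_pow_left₀ (norm_nonneg _) ?_ k
    calc ‖x‖ = ‖(x - center m) + center m‖ := by rw [sub_add_cancel]
      _ ≤ ‖x - center m‖ + ‖center m‖ := norm_add_le _ _
      _ ≤ 1 + ‖center m‖ := by linarith
  -- (3) the Fourier series bound for `χ_m f`
  have hG : ∀ v, cut m f v ≠ 0 → ‖v - center m‖ < 1 / 4 := by
    intro v hv
    refine norm_sub_center_lt_of_cutoff_ne_zero fun h0 => hv ?_
    rw [cut_apply, h0, zero_smul]
  have h4 := norm_le_tsum_norm_fourier hG (hxm.trans (by norm_num))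
  have hsn : Summable fun n : ι → ℤ =>
      ‖𝓕 (cut m f : EuclideanSpace ℝ ι → ℂ) (intVec n)‖ := by
    simpa using summable_norm_fourier_intVec_mul_pow (cut m f) 0 (le_refl (0 : ℝ))
  -- (4) summability bookkeeping and assembly
  have hre₀ : Summable ((fun a => ‖phi k a f‖) ∘ Sum.inl) := hs.comp_injective Sum.inl_injective
  have him₀ : Summable ((fun a => ‖phi k a f‖) ∘ Sum.inr) := hs.comp_injective Sum.inr_injective
  have hsplit : ∑' a, ‖phi k a f‖ = ∑' a, ‖phiRe k a f‖ + ∑' a, ‖phiIm k a f‖ := by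
    simpa only [phi_inl, phi_inr] using Summable.tsum_sum hre₀ him₀
  have hre : Summable fun a : (ι → ℤ) × (ι → ℤ) => ‖phiRe k a f‖ := by
    simpa only [Function.comp_def, phi_inl] using hre₀
  have him : Summable fun a : (ι → ℤ) × (ι → ℤ) => ‖phiIm k a f‖ := by
    simpa only [Function.comp_def, phi_inr] using him₀
  have hre' : Summable fun n : ι → ℤ => ‖phiRe k (m, n) f‖ :=
    hre.comp_injective (Prod.mk_right_injective m)
  have him' : Summable fun n : ι → ℤ => ‖phiIm k (m, n) f‖ :=
    him.comp_injective (Prod.mk_right_injective m)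
  calc ‖x‖ ^ k * ‖f x‖ = ‖x‖ ^ k * ‖cut m f x‖ := by rw [hGx]
    _ ≤ weight k m * ∑' n : ι → ℤ, ‖𝓕 (cut m f : EuclideanSpace ℝ ι → ℂ) (intVec n)‖ :=
        mul_le_mul hw h4 (norm_nonneg _) (weight_pos k m).le
    _ = ∑' n : ι → ℤ, weight k m * ‖𝓕 (cut m f : EuclideanSpace ℝ ι → ℂ) (intVec n)‖ := by
        rw [tsum_mul_left]
    _ ≤ ∑' n : ι → ℤ, (‖phiRe k (m, n) f‖ + ‖phiIm k (m, n) f‖) :=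
        (hsn.mul_left _).tsum_le_tsum (fun n => weight_mul_norm_le k (m, n) f) (hre'.add him')
    _ = ∑' n : ι → ℤ, ‖phiRe k (m, n) f‖ + ∑' n : ι → ℤ, ‖phiIm k (m, n) f‖ :=
        hre'.tsum_add him'
    _ ≤ ∑' a, ‖phiRe k a f‖ + ∑' a, ‖phiIm k a f‖ :=
        add_le_add
          (Summable.tsum_le_tsum_of_inj (fun n => (m, n)) (Prod.mk_right_injective m)
            (fun _ _ => norm_nonneg _) (fun _ => le_rfl) hre' hre)
          (Summable.tsum_le_tsum_of_inj (fun n => (m, n)) (Prod.mk_right_injective m)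
            (fun _ _ => norm_nonneg _) (fun _ => le_rfl) him' him)
    _ = ∑' a, ‖phi k a f‖ := hsplit.symm

/-! ### The exported order-zero domination -/

/-- **Nuclear domination of the order-zero Schwartz seminorms.** For every `k` there are a
continuous seminorm `q` on `𝓢(ℝ^ι, ℂ)` (a finite supremum of Schwartz seminorms), countably many
continuous real-linear functionals `φₐ` (`a ∈ (ℤ^ι × ℤ^ι) ⊕ (ℤ^ι × ℤ^ι)`: real and imaginary
parts of `(1 + ‖z_m‖)^k 𝓕(χ_m f)(n)`) and a summable family `cₐ ≥ 0` with `|φₐ(f)| ≤ cₐ q(f)` and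
`p_{k,0}(f) = sup_x ‖x‖^k |f(x)| ≤ ∑ₐ |φₐ(f)|`. This is the defining estimate of Pietsch's
seminorm form of nuclearity (Pietsch 1972, Prop. 4.1.4) for the seminorms `p_{k,0}` of `𝒮`.
[folklore] -/
theorem exists_nuclear_dominating_seminorm_zero (k : ℕ) :
    ∃ q : Seminorm ℝ 𝓢(EuclideanSpace ℝ ι, ℂ), Continuous q ∧
      ∃ (φ : ((ι → ℤ) × (ι → ℤ)) ⊕ ((ι → ℤ) × (ι → ℤ)) → 𝓢(EuclideanSpace ℝ ι, ℂ) →L[ℝ] ℝ)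
        (c : ((ι → ℤ) × (ι → ℤ)) ⊕ ((ι → ℤ) × (ι → ℤ)) → ℝ≥0),
        Summable c ∧ (∀ a f, ‖φ a f‖ ≤ c a * q f) ∧
          ∀ f, SchwartzMap.seminorm ℝ k 0 f ≤ ∑' a, ‖φ a f‖ := by
  obtain ⟨q, hq, c, hc, hφ⟩ := exists_dominating (ι := ι) k
  refine ⟨q, hq, phi k, c, hc, hφ, fun f => ?_⟩
  have hs : Summable fun a => ‖phi k a f‖ :=
    Summable.of_nonneg_of_le (fun _ => norm_nonneg _) (fun a => hφ a f)
      ((NNReal.summable_coe.2 hc).mul_right (q f))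
  refine SchwartzMap.seminorm_le_bound ℝ k 0 f (tsum_nonneg fun _ => norm_nonneg _) fun x => ?_
  rw [norm_iteratedFDeriv_zero]
  exact pow_mul_norm_le_tsum k f hs x

end SchwartzNuclear

end Literature.Analysis.FunctionSpaces
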